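import Summits.Parity.BatemanHorn.Theses.LambertRoots

/-!
# Birth skeleton — crux `NearWindow` (route `LambertRoots`, item `stmt-Parity-16278`)

Line `birth` (skeleton registrar, BC3; planner-skel-stmt-Parity-16278-0, 2026-08-17).

The crux (verbatim, `Summit.Parity.BatemanHorn.Theses.LambertRoots.NearWindow`): for every
Bateman–Horn system `f = (f₁,…,f_k)` there are `A, η > 0` with

  `S_{A,η}(x) := Σ_{1 ≤ n ≤ x²} e^{−n/x} Σ_{d : dᵢ ∣ fᵢ(n) (fᵢ(n) > 0), L(d) ∈ W} w(d) = o(x)`,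

where `L(d) = lcm(d₁,…,d_k)`, `w(d) = ∏ᵢ μ(dᵢ) log dᵢ` and `W = W_{A,η}(x) = (x (log x)^A, x^{1+η}]`.

THE CUT (the route's own reading of the crux, crux docstring: "after exchanging sums … a
∏μ·log-signed SMOOTH small-root statistic, kernel `e^{−(ν/L)(L/x)}`"). Exchange `n ↔ (d, ν, m)`:
`n = ν + mL` with `ν ∈ [1, L]` a JOINT ROOT CLASS of `d` (`dᵢ ∣ fᵢ(ν)` and `fᵢ(ν) > 0` for all `i` —
the positivity mirrors `Int.toNat`/`Nat.divisors` in the crux and matters exactly for systems with a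
linear member `X − r`) and `m ≥ 0`. Since `L > x (log x)^A`, every later period `m ≥ 1` has
`n > x(log x)^A` and is killed by `e^{−n/x} ≤ e^{−(log x)^A}`; the first period `m = 0` is the smooth
small-root statistic `Σ_ν e^{−T·(ν/L)}` at HEIGHT `T = L/x ∈ ((log x)^A, x^η]`, whose kernel
`φ_T(a) = e^{−Ta}` on `(0,1]` has mean `∫₀¹ φ_T = (1 − e^{−T})/T = (x/L)(1 − e^{−L/x})`. So, with
`ρ⁺(d) = #{joint root classes}`,

  `S = [S − (Z + O)] + Z + O`,
  `Z_{A,η}(x) := Σ_{L(d) ∈ W} w(d) ρ⁺(d) (x/L)(1 − e^{−L/x})`            (MEAN / zero mode),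
  `O_{A,η}(x) := Σ_{L(d) ∈ W} w(d) Σ_ν [e^{−ν/x} − (x/L)(1 − e^{−L/x})]`   (mean-zero OSCILLATION),

and the line is the three named pieces:

* `stub_reduce` (EXCHANGE + LATER PERIODS; theorem-grade, size M; for every `A > 1`, `η > 0`):
  `S − (Z + O) = o(x)`. Content: the Fubini step above (every contributing `d` has
  `1 ≤ dᵢ ≤ L ≤ x^{1+η}`, so the modulus side ranges over `d ∈ [1, ⌊x^{1+η}⌋]^k`), the periods
  `m ≥ 1` (`≤ (log x^{1+η})^k · max_n ∏ᵢ τ(fᵢ(n)) · Σ_{n > x(log x)^A} e^{−n/x} ≤ x^{O(1)} e^{−(log x)^A}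
  = o(1)` because `A > 1`; with Nair–Tenenbaum divisor sums any `A > 0` would do) and the overshoot
  `ν ∈ (x², L]` (only if `η ≥ 1`; `≤ e^{−x}·x^{O(1)}`).
* `stub_mean` (ZERO MODE = TAIL OF THE lcm-ORDERED SINGULAR SERIES; theorem-grade, size L; every
  `A, η > 0`): `Z = o(x)`. Content: `Z/x = Σ_{L ∈ W} w(d)ρ⁺(d)/L − Σ_{L∈W} w(d)ρ⁺(d)e^{−L/x}/L`; the
  second sum is `≤ e^{−(log x)^A}·(log x)^{O(1)}` (`ρ(d)/L ≤ ∏_{p∣L} g/p`); the first is a difference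
  of two partial sums of the lcm-ordered singular series `Σ_d w(d)ρ(d)/L(d)`, which CONVERGES (to
  `(−1)^k C(f)`: support `SingularSeriesLcm`, stmt-Parity-16280 — prime ideal theorem with
  de la Vallée-Poussin error in the splitting fields; Conrad2003HardyLittlewoodConstants Thm 7 for
  `k = 1`), up to the degenerate classes `ν ≤ n₀` of a linear member `X − r` (present in `ρ`, absent
  from `ρ⁺`), which cost tails of the convergent `Σ μ(d) log d/d`-type series — also `o(1)`.
* `stub_osc` (THE HEART — the ∏μ·log-signed mean-zero smooth small-root statistic; OPEN, size XL
  for any member of degree ≥ 2; `∃ A > 1, η > 0`): `O = o(x)`. Fourier side at height `T`: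
  `φ_T − mean = Σ_{j ≠ 0} ĉ_j(T) e(ja)`, `ĉ_j(T) = (1 − e^{−T})/(T + 2πij)`, so the block `L ≍ Λ = Tx`
  is `Σ_{j≠0} ĉ_j(T)·M_j(Λ)` with the route's twisted joint-root Weyl sums
  `M_j(Λ) = Σ_{L(d)≍Λ} w(d) Σ_ν e(jν/L)` (crux `MuRootWeyl` = log-power saving at `|j| ≤ (log)^B`):
  frequencies up to `|j| ≈ T(log x)^B` and a saving `≈ T(log x)^{B+2}` are needed, i.e. POWER-uniform,
  power-saving μ-twisted root Weyl sums at the top of the window `T = x^η` (evidence on this item by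
  idea-node g11/g14: `GaussianFractions.RootFractionsBound`-class for `n²+1`; Type I beyond level
  `X^{1/2}`). For LINEAR members the roots sit at `ν/L → 1` where `φ_T` is tiny and `O ≈ −Z = o(x)` by
  the prime number theorem — the cancellation is ACROSS `j`, which is why no frequency-wise
  absolute-value statement is registered as a stub (it would be quasi-RH for `f = X + h`).

`NearWindow_of : __Registered.stub_reduce → __Registered.stub_mean → __Registered.stub_osc → NearWindow` (the
hypotheses are the three stub statements under name-keyed `abbrev` aliases, see below) is a real proof
(three-term identity + `IsLittleO.add`), `NearWindow_proof : NearWindow` plugs the registered stubs in BY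
NAME, and
`window_iff_osc` (sorry-free) records EXACTNESS: given the two theorem-grade stubs, for every `A > 1`,
`η > 0` the crux's window bound `S_{A,η} = o(x)` and the oscillation bound `O_{A,η} = o(x)` are
EQUIVALENT — the line loses nothing, and `stub_osc` is NearWindow in the modulus-side, mean-zero form
that root-Weyl-sum technology (DukeFriedlanderIwaniec1995, Toth2000, Hooley1964; Kloosterman
fractions DukeFriedlanderIwaniec1997 for the CRT phases of `k ≥ 2`) acts on.

Disproof used: none relevant — no `Disproof.lean`, no `Negative/` lemma for this crux
(`ledger crux ls stmt-Parity-16278`: no workfiles before this line, 2026-08-17); negatives index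
(`ledger negatives --problem Parity`) has no statement about lcm-windowed μ-weighted root statistics.
Degenerate instances checked by hand: `k = 0` (empty system: `L = 1 ∉ W`, all three statistics vanish
for `x ≥ 3`); `f = (X + h)`, `f = (X − r)` (ρ⁺ drops the class `ν = r`; all stubs reduce to PNT-size
statements with the convergent factor `1/L`, none to `Σ_{d≤x^{1+η}} μ(d) log d = o(x)`).
-/

noncomputable section

namespace Summit.Parity.BatemanHorn.Cruxes.NearWindow.Birth

open scoped BigOperators Topology Manifold Classical MeasureTheory ProbabilityTheory Matrix InnerProductSpace ComplexConjugate ContinuousMap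
open Filter Set Function TopologicalSpace MeasureTheory

/-! ### Registered stubs (the ONLY `sorry`s of this file)

Notation inside the signatures (all inlined, no auxiliary definitions — a Theorems file can restate
any stub verbatim): `L = Finset.univ.lcm d`; window `x·(log x)^A < L ≤ x^(1+η)`; weight
`w(d) = ∏ i, μ(d i)·log(d i)`; joint root classes
`R⁺(d) = {ν ∈ [1, L] : ∀ i, 0 < fᵢ(ν) ∧ dᵢ ∣ fᵢ(ν)}` (so `ν = L` represents the class `0`), `ρ⁺(d) = #R⁺(d)`;
kernel mean `(x/L)(1 − e^{−L/x})`; modulus range `d ∈ [1, ⌊x^(1+η)⌋]^k` (it contains every tuple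
with `L` in the window). `S` = the crux's double sum verbatim; `Z`, `O` as in the module docstring. -/

/-- STUB R — EXCHANGE AND LATER PERIODS (theorem-grade, size M). For every Bateman–Horn system,
every `A > 1` and `η > 0`: `S_{A,η}(x) − (Z_{A,η}(x) + O_{A,η}(x)) = o(x)`, where `S` is the crux's
double sum verbatim and `Z + O = Σ_{L(d)∈W} w(d) Σ_{ν ∈ R⁺(d)} e^{−ν/x}` is its first period after
the exchange `n = ν + mL`. Why true: periods `m ≥ 1` have `n > L > x(log x)^A`, and
`Σ_{n>x(log x)^A} e^{−n/x} (log x^{1+η})^k ∏ᵢ τ(fᵢ(n)) ≤ x^{O(1)} e^{−(log x)^A} → 0` for `A > 1`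
(crude `τ(m) ≤ 2√m`); the overshoot `ν ∈ (x², L]` costs `≤ e^{−x} x^{O(1)}`. Why it might fail: only
by a bookkeeping slip (range `[1, ⌊x^{1+η}⌋]^k`, positivity `fᵢ(ν) > 0` vs `Int.toNat`, `ν = L`
representing the class `0`). Leans on: Mathlib `Nat.mem_divisors`, `Finset.dvd_lcm`, `Finset.sum_comm`,
`Nat.card_divisors_le_self` (crude divisor bound), `Real.add_one_le_exp` (geometric tails).
[cite: HindryRivoal2005Golomb, (14)] -/
theorem stub_reduce :
  ∀ (k : ℕ) (f : Fin k → Polynomial ℤ), Literature.NumberTheory.Sieve.IsBatemanHornSystem f →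
    ∀ A η : ℝ, 1 < A → 0 < η →
    (fun x : ℕ =>
      (∑ n ∈ Finset.Icc 1 (x ^ 2), Real.exp (-((n : ℝ) / x)) *
        ∑ d ∈ Fintype.piFinset (fun i => (((f i).eval (n : ℤ)).toNat).divisors),
          if (x : ℝ) * Real.log x ^ A < ((Finset.univ.lcm d : ℕ) : ℝ) ∧
              ((Finset.univ.lcm d : ℕ) : ℝ) ≤ (x : ℝ) ^ (1 + η) then
            ∏ i, ((ArithmeticFunction.moebius (d i) : ℝ) * Real.log (d i)) else 0) -
      ((∑ d ∈ Fintype.piFinset (fun _ : Fin k => Finset.Icc 1 ⌊(x : ℝ) ^ (1 + η)⌋₊),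
          if (x : ℝ) * Real.log x ^ A < ((Finset.univ.lcm d : ℕ) : ℝ) ∧
              ((Finset.univ.lcm d : ℕ) : ℝ) ≤ (x : ℝ) ^ (1 + η) then
            (∏ i, ((ArithmeticFunction.moebius (d i) : ℝ) * Real.log (d i))) *
              ((((Finset.Icc 1 (Finset.univ.lcm d)).filter (fun ν : ℕ =>
                  ∀ i, 0 < (f i).eval (ν : ℤ) ∧ ((d i : ℕ) : ℤ) ∣ (f i).eval (ν : ℤ))).card : ℝ) *
                (((x : ℝ) / ((Finset.univ.lcm d : ℕ) : ℝ)) *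
                  (1 - Real.exp (-(((Finset.univ.lcm d : ℕ) : ℝ) / x)))))
          else 0) +
        (∑ d ∈ Fintype.piFinset (fun _ : Fin k => Finset.Icc 1 ⌊(x : ℝ) ^ (1 + η)⌋₊),
          if (x : ℝ) * Real.log x ^ A < ((Finset.univ.lcm d : ℕ) : ℝ) ∧
              ((Finset.univ.lcm d : ℕ) : ℝ) ≤ (x : ℝ) ^ (1 + η) then
            (∏ i, ((ArithmeticFunction.moebius (d i) : ℝ) * Real.log (d i))) *
              ∑ ν ∈ (Finset.Icc 1 (Finset.univ.lcm d)).filter (fun ν : ℕ =>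
                  ∀ i, 0 < (f i).eval (ν : ℤ) ∧ ((d i : ℕ) : ℤ) ∣ (f i).eval (ν : ℤ)),
                (Real.exp (-((ν : ℝ) / x)) -
                  ((x : ℝ) / ((Finset.univ.lcm d : ℕ) : ℝ)) *
                    (1 - Real.exp (-(((Finset.univ.lcm d : ℕ) : ℝ) / x))))
          else 0)))
    =o[Filter.atTop] fun x : ℕ => (x : ℝ) := by
  sorry

/-- STUB Z — THE ZERO MODE IS THE TAIL OF THE lcm-ORDERED SINGULAR SERIES (theorem-grade, size L).
For every Bateman–Horn system, every `A > 0` and `η > 0`: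
`Z_{A,η}(x) = Σ_{L(d) ∈ W} w(d) ρ⁺(d) (x/L)(1 − e^{−L/x}) = o(x)`. Why true: `Z/x` is the difference
of the partial sums at `x^{1+η}` and `x(log x)^A` of the CONVERGENT lcm-ordered singular series
`Σ_d w(d)ρ(d)/L(d)` (support `SingularSeriesLcm`, stmt-Parity-16280; prime ideal theorem with
classical error term in the splitting fields of the `fᵢ`), minus `Σ_{L∈W} w ρ⁺ e^{−L/x}/L`, which is
`≤ e^{−(log x)^A} (log x)^{O(1)}` by `ρ(d)/L(d) ≤ ∏_{p ∣ L} (max deg fᵢ)/p`; the classes `ν ≤ n₀`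
of a linear member `X − r` (in `ρ`, not in `ρ⁺`) contribute tails of convergent
`Σ μ(d) log d · c(d)/d` series. Why it might fail: convergence of the lcm-ORDERED (not
product-ordered) series for `k ≥ 2` is Conrad's Theorem 7 only after a re-grouping whose error must
be summable — a genuine but standard zero-free-region argument. Leans on: Mathlib
`ArithmeticFunction.moebius`, Dedekind zeta zero-free region (not in Mathlib: Literature facts of
the Chebotarev/prime-ideal-theorem family), `Literature.NumberTheory.Sieve.HasBatemanHornConst`.
[cite: Conrad2003HardyLittlewoodConstants, Theorem 7] -/
theorem stub_mean :
  ∀ (k : ℕ) (f : Fin k → Polynomial ℤ), Literature.NumberTheory.Sieve.IsBatemanHornSystem f →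
    ∀ A η : ℝ, 0 < A → 0 < η →
    (fun x : ℕ =>
      ∑ d ∈ Fintype.piFinset (fun _ : Fin k => Finset.Icc 1 ⌊(x : ℝ) ^ (1 + η)⌋₊),
        if (x : ℝ) * Real.log x ^ A < ((Finset.univ.lcm d : ℕ) : ℝ) ∧
            ((Finset.univ.lcm d : ℕ) : ℝ) ≤ (x : ℝ) ^ (1 + η) then
          (∏ i, ((ArithmeticFunction.moebius (d i) : ℝ) * Real.log (d i))) *
            ((((Finset.Icc 1 (Finset.univ.lcm d)).filter (fun ν : ℕ =>
                ∀ i, 0 < (f i).eval (ν : ℤ) ∧ ((d i : ℕ) : ℤ) ∣ (f i).eval (ν : ℤ))).card : ℝ) *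
              (((x : ℝ) / ((Finset.univ.lcm d : ℕ) : ℝ)) *
                (1 - Real.exp (-(((Finset.univ.lcm d : ℕ) : ℝ) / x)))))
        else 0)
    =o[Filter.atTop] fun x : ℕ => (x : ℝ) := by
  sorry

/-- STUB O — THE HEART: the ∏μ·log-signed, mean-zero, smooth small-root statistic (OPEN; size XL
for any member of degree ≥ 2; PNT-grade for linear systems). For every Bateman–Horn system there
are `A > 1` and `η > 0` with
`O_{A,η}(x) = Σ_{L(d) ∈ W} w(d) Σ_{ν ∈ R⁺(d)} [e^{−ν/x} − (x/L)(1 − e^{−L/x})] = o(x)`: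
the joint root classes `ν/L ∈ (0,1]` of the window moduli, tested against the mean-zero kernel
`φ_T − ∫φ_T`, `φ_T(a) = e^{−Ta}`, at every height `T = L/x ∈ ((log x)^A, x^η]`, with the sign
`∏ᵢ μ(dᵢ) log dᵢ`. Why plausibly true: it is the crux in modulus-side mean-zero form
(`window_iff_osc` below: equivalent to NearWindow's window bound for each `A > 1, η > 0`, given
stubs R and Z); Möbius-randomness heuristics in the modulus. Why it might fail / what it needs: at
height `T` the Fourier coefficients `ĉ_j(T) = (1−e^{−T})/(T+2πij)` do not decay before `|j| ≈ T`, so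
frequency-wise one needs μ-twisted joint-root Weyl sums `M_j(Λ)` with saving `≈ T·polylog`
uniformly in `0 < |j| ≤ T(log x)^B`, `T` up to `x^η` — POWER-uniform power saving, beyond the
route's `MuRootWeyl` (log saving, polylog frequencies) and of `GaussianFractions.RootFractionsBound`
class for `n² + 1` (idea-node evidence g11/g14 on this item: Type I beyond level `X^{1/2}`); for
`deg ≥ 3` even untwisted prime-moduli equidistribution with a rate is open
(KowalskiSoundararajan2021 Conj. A.2). Leans on: `Literature.NumberTheory.Sieve.polyRootWeylSum`
(the `k = 1` inner sums), `toth2000_weylLinearForm` / `toth2000_bilinearForm`,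
`dukeFriedlanderIwaniec1995_proposition4_holds` (degree 2 inputs).
[cite: DukeFriedlanderIwaniec1995, Propositions 1–4; Toth2000; Hooley1964; DukeFriedlanderIwaniec1997] -/
theorem stub_osc :
  ∀ (k : ℕ) (f : Fin k → Polynomial ℤ), Literature.NumberTheory.Sieve.IsBatemanHornSystem f →
    ∃ A η : ℝ, 1 < A ∧ 0 < η ∧
    (fun x : ℕ =>
      ∑ d ∈ Fintype.piFinset (fun _ : Fin k => Finset.Icc 1 ⌊(x : ℝ) ^ (1 + η)⌋₊),
        if (x : ℝ) * Real.log x ^ A < ((Finset.univ.lcm d : ℕ) : ℝ) ∧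
            ((Finset.univ.lcm d : ℕ) : ℝ) ≤ (x : ℝ) ^ (1 + η) then
          (∏ i, ((ArithmeticFunction.moebius (d i) : ℝ) * Real.log (d i))) *
            ∑ ν ∈ (Finset.Icc 1 (Finset.univ.lcm d)).filter (fun ν : ℕ =>
                ∀ i, 0 < (f i).eval (ν : ℤ) ∧ ((d i : ℕ) : ℤ) ∣ (f i).eval (ν : ℤ)),
              (Real.exp (-((ν : ℝ) / x)) -
                ((x : ℝ) / ((Finset.univ.lcm d : ℕ) : ℝ)) *
                  (1 - Real.exp (-(((Finset.univ.lcm d : ℕ) : ℝ) / x))))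
        else 0)
    =o[Filter.atTop] fun x : ℕ => (x : ℝ) := by
  sorry

/-! ### Name-keyed aliases of the three stub statements — the hypotheses of `NearWindow_of`

The native skeleton audit (`#h21_check_skeleton`, run by `ledger skeleton check`) admits a hypothesis of
the composing theorem only if its head constant is a registered obligation or is NAMED like a declared
stub; `__Registered.stub_X` is the statement of `stub_X` under the stub's short name (device of
`AnomalousDissipation/…/Cruxes/MirrorFloorTG/Lines/birth.lean`; the `__` namespace is an implementation
detail, so the audit's stub report resolves each `stub_…` to the sorried theorem with its full
signature, not to the alias; the gate-reserved `@[stub]` attribute is not written by a planner).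
Each alias is an `abbrev`, definitionally (indeed syntactically) the registered statement. -/
namespace __Registered

/-- Alias of the statement of `stub_reduce`, keyed by the registered stub name. -/
abbrev stub_reduce : Prop :=
  ∀ (k : ℕ) (f : Fin k → Polynomial ℤ), Literature.NumberTheory.Sieve.IsBatemanHornSystem f →
    ∀ A η : ℝ, 1 < A → 0 < η →
    (fun x : ℕ =>
      (∑ n ∈ Finset.Icc 1 (x ^ 2), Real.exp (-((n : ℝ) / x)) *
        ∑ d ∈ Fintype.piFinset (fun i => (((f i).eval (n : ℤ)).toNat).divisors),
          if (x : ℝ) * Real.log x ^ A < ((Finset.univ.lcm d : ℕ) : ℝ) ∧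
              ((Finset.univ.lcm d : ℕ) : ℝ) ≤ (x : ℝ) ^ (1 + η) then
            ∏ i, ((ArithmeticFunction.moebius (d i) : ℝ) * Real.log (d i)) else 0) -
      ((∑ d ∈ Fintype.piFinset (fun _ : Fin k => Finset.Icc 1 ⌊(x : ℝ) ^ (1 + η)⌋₊),
          if (x : ℝ) * Real.log x ^ A < ((Finset.univ.lcm d : ℕ) : ℝ) ∧
              ((Finset.univ.lcm d : ℕ) : ℝ) ≤ (x : ℝ) ^ (1 + η) then
            (∏ i, ((ArithmeticFunction.moebius (d i) : ℝ) * Real.log (d i))) *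
              ((((Finset.Icc 1 (Finset.univ.lcm d)).filter (fun ν : ℕ =>
                  ∀ i, 0 < (f i).eval (ν : ℤ) ∧ ((d i : ℕ) : ℤ) ∣ (f i).eval (ν : ℤ))).card : ℝ) *
                (((x : ℝ) / ((Finset.univ.lcm d : ℕ) : ℝ)) *
                  (1 - Real.exp (-(((Finset.univ.lcm d : ℕ) : ℝ) / x)))))
          else 0) +
        (∑ d ∈ Fintype.piFinset (fun _ : Fin k => Finset.Icc 1 ⌊(x : ℝ) ^ (1 + η)⌋₊),
          if (x : ℝ) * Real.log x ^ A < ((Finset.univ.lcm d : ℕ) : ℝ) ∧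
              ((Finset.univ.lcm d : ℕ) : ℝ) ≤ (x : ℝ) ^ (1 + η) then
            (∏ i, ((ArithmeticFunction.moebius (d i) : ℝ) * Real.log (d i))) *
              ∑ ν ∈ (Finset.Icc 1 (Finset.univ.lcm d)).filter (fun ν : ℕ =>
                  ∀ i, 0 < (f i).eval (ν : ℤ) ∧ ((d i : ℕ) : ℤ) ∣ (f i).eval (ν : ℤ)),
                (Real.exp (-((ν : ℝ) / x)) -
                  ((x : ℝ) / ((Finset.univ.lcm d : ℕ) : ℝ)) *
                    (1 - Real.exp (-(((Finset.univ.lcm d : ℕ) : ℝ) / x))))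
          else 0)))
    =o[Filter.atTop] fun x : ℕ => (x : ℝ)

/-- Alias of the statement of `stub_mean`, keyed by the registered stub name. -/
abbrev stub_mean : Prop :=
  ∀ (k : ℕ) (f : Fin k → Polynomial ℤ), Literature.NumberTheory.Sieve.IsBatemanHornSystem f →
    ∀ A η : ℝ, 0 < A → 0 < η →
    (fun x : ℕ =>
      ∑ d ∈ Fintype.piFinset (fun _ : Fin k => Finset.Icc 1 ⌊(x : ℝ) ^ (1 + η)⌋₊),
        if (x : ℝ) * Real.log x ^ A < ((Finset.univ.lcm d : ℕ) : ℝ) ∧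
            ((Finset.univ.lcm d : ℕ) : ℝ) ≤ (x : ℝ) ^ (1 + η) then
          (∏ i, ((ArithmeticFunction.moebius (d i) : ℝ) * Real.log (d i))) *
            ((((Finset.Icc 1 (Finset.univ.lcm d)).filter (fun ν : ℕ =>
                ∀ i, 0 < (f i).eval (ν : ℤ) ∧ ((d i : ℕ) : ℤ) ∣ (f i).eval (ν : ℤ))).card : ℝ) *
              (((x : ℝ) / ((Finset.univ.lcm d : ℕ) : ℝ)) *
                (1 - Real.exp (-(((Finset.univ.lcm d : ℕ) : ℝ) / x)))))
        else 0)
    =o[Filter.atTop] fun x : ℕ => (x : ℝ)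

/-- Alias of the statement of `stub_osc`, keyed by the registered stub name. -/
abbrev stub_osc : Prop :=
  ∀ (k : ℕ) (f : Fin k → Polynomial ℤ), Literature.NumberTheory.Sieve.IsBatemanHornSystem f →
    ∃ A η : ℝ, 1 < A ∧ 0 < η ∧
    (fun x : ℕ =>
      ∑ d ∈ Fintype.piFinset (fun _ : Fin k => Finset.Icc 1 ⌊(x : ℝ) ^ (1 + η)⌋₊),
        if (x : ℝ) * Real.log x ^ A < ((Finset.univ.lcm d : ℕ) : ℝ) ∧
            ((Finset.univ.lcm d : ℕ) : ℝ) ≤ (x : ℝ) ^ (1 + η) then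
          (∏ i, ((ArithmeticFunction.moebius (d i) : ℝ) * Real.log (d i))) *
            ∑ ν ∈ (Finset.Icc 1 (Finset.univ.lcm d)).filter (fun ν : ℕ =>
                ∀ i, 0 < (f i).eval (ν : ℤ) ∧ ((d i : ℕ) : ℤ) ∣ (f i).eval (ν : ℤ)),
              (Real.exp (-((ν : ℝ) / x)) -
                ((x : ℝ) / ((Finset.univ.lcm d : ℕ) : ℝ)) *
                  (1 - Real.exp (-(((Finset.univ.lcm d : ℕ) : ℝ) / x))))
        else 0)
    =o[Filter.atTop] fun x : ℕ => (x : ℝ)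

end __Registered

/-! ### The composition: the three stubs imply the crux, by name -/

/-- **THE SKELETON THEOREM.** `stub_reduce → stub_mean → stub_osc →
Summit.Parity.BatemanHorn.Theses.LambertRoots.NearWindow` (hypotheses = the three registered statements,
through their name-keyed aliases), a real proof (no `sorry`): for the system `(k, f)` take the
`A > 1, η > 0` of stub O; the crux's sequence is `[S − (Z + O)] + Z + O` identically in `x` (`ring`),
and the three pieces are `o(x)` by stubs R, Z, O (`IsLittleO.add`). Every stub is consumed. [folklore] -/
theorem NearWindow_of :
    __Registered.stub_reduce → __Registered.stub_mean → __Registered.stub_osc →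
      Summit.Parity.BatemanHorn.Theses.LambertRoots.NearWindow := by
  intro hR hZ hO k f hf
  obtain ⟨A, η, hA, hη, hO'⟩ := hO k f hf
  have hA0 : (0 : ℝ) < A := one_pos.trans hA
  have h1 := hR k f hf A η hA hη
  have h2 := hZ k f hf A η hA0 hη
  have key := (h1.add h2).add hO'
  refine ⟨A, η, hA0, hη, ?_⟩
  refine key.congr_left ?_
  intro x
  ring

/-- The skeleton in its final shape: the crux BY NAME from the three registered stubs (which are
definitionally their aliases); it becomes the crux proof when the last `stub_*` is discharged (until
then it depends on `sorryAx` through the stubs only — no `sorry` of its own). [folklore] -/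
theorem NearWindow_proof : Summit.Parity.BatemanHorn.Theses.LambertRoots.NearWindow :=
  NearWindow_of stub_reduce stub_mean stub_osc

/-! ### Exactness (sorry-free): modulo stubs R and Z the heart IS the crux, window by window -/

/-- EXACTNESS OF THE CUT. Given the two theorem-grade stubs R and Z, for every Bateman–Horn system
and every `A > 1`, `η > 0`, the crux's window bound `S_{A,η} = o(x)` and the oscillation bound
`O_{A,η} = o(x)` of stub O are EQUIVALENT (`O = S − [S − (Z+O)] − Z` and `S = [S − (Z+O)] + Z + O`).
So the line loses nothing: refuting stub O at some `(A, η)` with `A > 1` refutes the crux's bound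
for that window, and any proof of the crux with `A > 1` proves stub O there. [folklore] -/
theorem window_iff_osc (hR : __Registered.stub_reduce) (hZ : __Registered.stub_mean) :
    ∀ (k : ℕ) (f : Fin k → Polynomial ℤ), Literature.NumberTheory.Sieve.IsBatemanHornSystem f →
    ∀ A η : ℝ, 1 < A → 0 < η →
    (((fun x : ℕ =>
      ∑ n ∈ Finset.Icc 1 (x ^ 2), Real.exp (-((n : ℝ) / x)) *
        ∑ d ∈ Fintype.piFinset (fun i => (((f i).eval (n : ℤ)).toNat).divisors),
          if (x : ℝ) * Real.log x ^ A < ((Finset.univ.lcm d : ℕ) : ℝ) ∧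
              ((Finset.univ.lcm d : ℕ) : ℝ) ≤ (x : ℝ) ^ (1 + η) then
            ∏ i, ((ArithmeticFunction.moebius (d i) : ℝ) * Real.log (d i)) else 0)
      =o[Filter.atTop] fun x : ℕ => (x : ℝ)) ↔
    ((fun x : ℕ =>
      ∑ d ∈ Fintype.piFinset (fun _ : Fin k => Finset.Icc 1 ⌊(x : ℝ) ^ (1 + η)⌋₊),
        if (x : ℝ) * Real.log x ^ A < ((Finset.univ.lcm d : ℕ) : ℝ) ∧
            ((Finset.univ.lcm d : ℕ) : ℝ) ≤ (x : ℝ) ^ (1 + η) then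
          (∏ i, ((ArithmeticFunction.moebius (d i) : ℝ) * Real.log (d i))) *
            ∑ ν ∈ (Finset.Icc 1 (Finset.univ.lcm d)).filter (fun ν : ℕ =>
                ∀ i, 0 < (f i).eval (ν : ℤ) ∧ ((d i : ℕ) : ℤ) ∣ (f i).eval (ν : ℤ)),
              (Real.exp (-((ν : ℝ) / x)) -
                ((x : ℝ) / ((Finset.univ.lcm d : ℕ) : ℝ)) *
                  (1 - Real.exp (-(((Finset.univ.lcm d : ℕ) : ℝ) / x))))
        else 0)
      =o[Filter.atTop] fun x : ℕ => (x : ℝ))) := by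
  intro k f hf A η hA hη
  have hA0 : (0 : ℝ) < A := one_pos.trans hA
  have h1 := hR k f hf A η hA hη
  have h2 := hZ k f hf A η hA0 hη
  constructor
  · intro hS
    have key := (hS.sub h1).sub h2
    refine key.congr_left ?_
    intro x
    ring
  · intro hO
    have key := (h1.add h2).add hO
    refine key.congr_left ?_
    intro x
    ring

end Summit.Parity.BatemanHorn.Cruxes.NearWindow.Birth

end
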